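import Summits.BirchSwinnertonDyer.Rank1Residual.X11b.LocalTrivialityBridge
import Literature.NumberTheory.GaloisRepresentations.GaloisCohomologyKummerProofs
import Literature.NumberTheory.IwasawaTheory.PruferPontryaginDual
import HarnessLib

/-!
# Crux `PrintCf2.SplitBadTwoRankOneOfFacts` (stmt-BirchSwinnertonDyer-20368), registered stub (REG₂) `stub_xRegular_two`, S3N-FACTFREE road R2
# (road (b)), brick B3e: THE COEFFICIENT MODELS — finite levels `ℤ/p^k ↪ ℤ/p^M` of a sign-twisted `ℚ_p/ℤ_p`, their Kummer duals
# `μ_{p^M} ↠ μ_{p^k}` with the matching sign twist, the perfect pairings and the transposes, ALL AS `Γ_K`-`DistribMulAction` TYPES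
# (what the `U`-currency bricks B2d p705484 / B3c p706017 / B3d p706446 / B3d′ and -w3 g13's class-level (PRO-NULL)_U quantify over)

Cell `bsd-print-cf2`, WIDTH seat `bsd-line-cf2-p1-w8` g5 (prover-bsd-line-cf2-p1-w8-g5-0); `--supports stmt-BirchSwinnertonDyer-20368`
(helper, Theses-free). HONEST FRAMING: nothing here closes the crux or a registered stub; BSD is not proved by any of this; no summit
statement is proved by this seat. No definition, no named fact, no `sorry` — the models are EXHIBITED inside the proof of ONE existence
theorem (carriers `ZMod (p^M)`, `ZMod (p^k)`, `MuCarrier K (p^M)`, `MuCarrier K (p^k)`, actions by `DistribMulAction.compHom`), so that no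
instance or type synonym is declared.

WHAT. **`exists_signLevelModels`**: `K` a field, `p` prime, `ε : Γ_K →* ℤˣ` a sign character with open kernel, `A` a discrete `Γ_K`-module
with open stabilisers on which `Γ_K` acts through `ε` (`σ • a = ε(σ) • a`) and an additive identification `e : A ≃+ ℚ_p/ℤ_p`, `k ≤ M`.
THEN there exist finite discrete `Γ_K`-modules `N₀, N, N₀′, N′` (open stabilisers, `p^M • N = 0`, `p^M • N′ = 0`, `Γ_K` acting on `N₀`, `N`
through `ε`), equivariant `j : N₀ → N`, `jD : N′ → N₀′`, `ι₀ : N₀ ↪ A` onto `⊇ A[p^k]`, `ι : N → A` with `ι ∘ j = ι₀`, equivariant pairings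
`B : N × N′ → μ_{p^M}` (PERFECT on the right: `ζ ↦ B(·, ζ)` bijective), `B₀ : N₀ × N₀′ → μ_{p^M}` with `B₀(m₀, jD ζ) = B(j m₀, ζ)`, and
`ε`-TWISTED KUMMER EMBEDDINGS `ι′ : N′ ↪ K̄ˣ`, `ι₀′ : N₀′ ↪ K̄ˣ` (`ι′(σ•ζ) = (σ•ι′ζ)^{ε σ}`, every `p^k`-th root of unity in the image of `ι₀′`,
`ι₀′ ∘ jD = (·)^{p^{M−k}} ∘ ι′`) — EVERY binder of B3d / B3d′ (`exists_level_levelSurj_of_classProNull[_twisted]`) and of B3c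
(`locSurj_torsionExponent_of_levelSurj`) that concerns the coefficient modules, plus `A` `p^k`-divisible. (`ε = 1` gives the untwisted case.)
presearch: Serre Local Fields X §3 (Kummer), Milne ADT I §0 (pairings); tree `QpModZp.tgen` API — plumbing, no new fact. beyond-print theorem: no.

References: [SerreLocalFields1979] X §3; [MilneADT2006] Ch. I §0; [Hungerford1974] Ch. I §3 Exercise 7.
-/

noncomputable section

open scoped Classical

set_option linter.dupNamespace false
set_option autoImplicit false

open Field
open Literature.NumberTheory.GaloisRepresentations Literature.NumberTheory.GaloisRepresentations.DiscreteGaloisModule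
open Literature.NumberTheory.IwasawaTheory
open Summit.BirchSwinnertonDyer.Rank1Residual.X11b.LocBridge

namespace Summit.BirchSwinnertonDyer.BirchSwinnertonDyer.Theorems.PrintCf2.LayerShapiro

variable {K : Type} [Field K] {p : ℕ} [Fact p.Prime]

/-- `p^N`-torsion elements of `ℚ_p/ℤ_p` are NATURAL multiples of `t_N`. [cite: Hungerford1974, Ch. I §3 Exercise 7 (b)] -/
theorem QpModZp_exists_eq_natCast_smul_tgen_of_nsmul_eq_zero {x : QpModZp p} {N : ℕ} (hx : p ^ N • x = 0) :
    ∃ m : ℕ, x = (m : ℤ_[p]) • QpModZp.tgen p N := by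
  have hp : p.Prime := Fact.out
  obtain ⟨n, u, rfl⟩ := QpModZp.exists_eq_smul_tgen x
  -- reduce to a `ℤ_p`-multiple of `t_N`
  suffices h : ∃ c : ℤ_[p], u • QpModZp.tgen p n = c • QpModZp.tgen p N by
    obtain ⟨c, hc⟩ := h
    refine ⟨c.appr N, ?_⟩
    rw [hc, QpModZp.smul_eq_appr_smul_of_nsmul_eq_zero (QpModZp.pow_nsmul_tgen N) c, Nat.cast_smul_eq_nsmul]
  rcases le_or_gt n N with hnN | hNn
  · obtain ⟨d, rfl⟩ := Nat.exists_eq_add_of_le hnN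
    refine ⟨u * (p : ℤ_[p]) ^ d, ?_⟩
    rw [mul_smul, QpModZp.pow_smul_tgen_add]
  · -- `p^N (u t_n) = 0` forces `p^{n-N} ∣ u`
    obtain ⟨d, rfl⟩ := Nat.exists_eq_add_of_lt hNn
    have h0 : ((p : ℤ_[p]) ^ N * u) • QpModZp.tgen p (N + d + 1) = 0 := by
      rw [mul_smul, ← Nat.cast_pow, Nat.cast_smul_eq_nsmul, hx]
    rw [QpModZp.smul_tgen_eq_zero_iff, Ideal.mem_span_singleton] at h0
    obtain ⟨w, hw⟩ := h0
    have hu : u = (p : ℤ_[p]) ^ (d + 1) * w := by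
      have hpN : ((p : ℤ_[p]) ^ N) ≠ 0 := pow_ne_zero _ (Nat.cast_ne_zero.2 hp.ne_zero)
      apply mul_left_cancel₀ hpN
      rw [hw, ← mul_assoc, ← pow_add, show N + d + 1 = N + (d + 1) by omega]
    refine ⟨w, ?_⟩
    rw [hu, mul_comm, mul_smul, show N + d + 1 = N + (d + 1) by omega, QpModZp.pow_smul_tgen_add]

/-- **THE COEFFICIENT MODELS.** See the module docstring. [cite: SerreLocalFields1979, X §3] [cite: MilneADT2006, Ch. I §0] -/
theorem exists_signLevelModels (ε : absoluteGaloisGroup K →* ℤˣ) (hε : IsOpen (ε.ker : Set (absoluteGaloisGroup K)))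
    {A : Type} [AddCommGroup A] [DistribMulAction (absoluteGaloisGroup K) A] [TopologicalSpace A] [DiscreteTopology A]
    (hAε : ∀ (σ : absoluteGaloisGroup K) (a : A), σ • a = ((ε σ : ℤˣ) : ℤ) • a) (e : A ≃+ QpModZp p)
    (k M : ℕ) (hkM : k ≤ M) :
    ∃ (N₀ N N₀' N' : Type)
      (_ : AddCommGroup N₀) (_ : DistribMulAction (absoluteGaloisGroup K) N₀) (_ : TopologicalSpace N₀) (_ : DiscreteTopology N₀)
      (_ : Finite N₀)
      (_ : AddCommGroup N) (_ : DistribMulAction (absoluteGaloisGroup K) N) (_ : TopologicalSpace N) (_ : DiscreteTopology N)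
      (_ : Finite N)
      (_ : AddCommGroup N₀') (_ : DistribMulAction (absoluteGaloisGroup K) N₀') (_ : TopologicalSpace N₀') (_ : DiscreteTopology N₀')
      (_ : AddCommGroup N') (_ : DistribMulAction (absoluteGaloisGroup K) N') (_ : TopologicalSpace N') (_ : DiscreteTopology N')
      (hN₀ : ∀ m : N₀, IsOpen {σ : absoluteGaloisGroup K | σ • m = m}) (hN : ∀ m : N, IsOpen {σ : absoluteGaloisGroup K | σ • m = m})
      (hN₀' : ∀ m : N₀', IsOpen {σ : absoluteGaloisGroup K | σ • m = m})
      (hN' : ∀ m : N', IsOpen {σ : absoluteGaloisGroup K | σ • m = m})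
      (j : N₀ →+ N) (ι₀ : N₀ →+ A) (ι : N →+ A) (B : N →+ N' →+ MuCarrier K (p ^ M)) (B₀ : N₀ →+ N₀' →+ MuCarrier K (p ^ M))
      (jD : N' →+ N₀') (ι' : N' →+ Additive (AlgebraicClosure K)ˣ) (ι₀' : N₀' →+ Additive (AlgebraicClosure K)ˣ),
      -- the `A`-side
      (∀ (σ : absoluteGaloisGroup K) (x : N₀), σ • x = ((ε σ : ℤˣ) : ℤ) • x) ∧
      (∀ (σ : absoluteGaloisGroup K) (x : N), σ • x = ((ε σ : ℤˣ) : ℤ) • x) ∧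
      (∀ x : N, p ^ M • x = 0) ∧
      (∀ (σ : absoluteGaloisGroup K) (m : N₀), j (σ • m) = σ • j m) ∧
      (∀ (σ : absoluteGaloisGroup K) (m : N₀), ι₀ (σ • m) = σ • ι₀ m) ∧ Function.Injective ι₀ ∧
      (∀ a : A, p ^ k • a = 0 → ∃ m, ι₀ m = a) ∧
      (∀ (σ : absoluteGaloisGroup K) (m : N), ι (σ • m) = σ • ι m) ∧ (∀ m, ι (j m) = ι₀ m) ∧
      (∀ a : A, ∃ b : A, p ^ k • b = a) ∧
      -- the dual side
      (∀ x : N', p ^ M • x = 0) ∧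
      (∀ (σ : absoluteGaloisGroup K) (m : N) (m' : N'), B (ofSMul N hN σ m) (ofSMul N' hN' σ m') = mu K (p ^ M) σ (B m m')) ∧
      (Function.Bijective fun m' : N' ↦ B.flip m') ∧
      (∀ (σ : absoluteGaloisGroup K) (m : N₀) (m' : N₀'),
        B₀ (ofSMul N₀ hN₀ σ m) (ofSMul N₀' hN₀' σ m') = mu K (p ^ M) σ (B₀ m m')) ∧
      (∀ (σ : absoluteGaloisGroup K) (m' : N'), jD (σ • m') = σ • jD m') ∧
      (∀ (m₀ : N₀) (m' : N'), B₀ m₀ (jD m') = B (j m₀) m') ∧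
      Function.Injective ι' ∧
      (∀ (g : absoluteGaloisGroup K) (x : N'), Additive.toMul (ι' (g • x)) = (g • Additive.toMul (ι' x)) ^ ((ε g : ℤˣ) : ℤ)) ∧
      Function.Injective ι₀' ∧
      (∀ (g : absoluteGaloisGroup K) (x : N₀'), Additive.toMul (ι₀' (g • x)) = (g • Additive.toMul (ι₀' x)) ^ ((ε g : ℤˣ) : ℤ)) ∧
      (∀ m : (AlgebraicClosure K)ˣ, m ^ p ^ k = 1 → ∃ a₀ : N₀', Additive.toMul (ι₀' a₀) = m) ∧
      (∀ x : N', Additive.toMul (ι₀' (jD x)) = Additive.toMul (ι' x) ^ p ^ (M - k)) := by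
  have hp : p.Prime := Fact.out
  obtain ⟨d, rfl⟩ := Nat.exists_eq_add_of_le hkM
  have hdk : k + d - k = d := by omega
  -- ### generic plumbing
  -- a set stable under right multiplication by an open set containing `1` is open
  have hopen_of_mul : ∀ (S H : Set (absoluteGaloisGroup K)), IsOpen H → (1 : absoluteGaloisGroup K) ∈ H →
      (∀ s ∈ S, ∀ h ∈ H, s * h ∈ S) → IsOpen S := by
    intro S H hH h1 hSH
    rw [isOpen_iff_forall_mem_open]
    intro s hs
    refine ⟨(fun h ↦ s * h) '' H, ?_, (Homeomorph.mulLeft s).isOpenMap _ hH, ⟨1, h1, mul_one s⟩⟩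
    rintro _ ⟨h, hh, rfl⟩
    exact hSH s hs h hh
  -- the kernel of `ε` and the stabilisers of `μ` are open neighbourhoods of `1`
  have hker1 : (1 : absoluteGaloisGroup K) ∈ (ε.ker : Set (absoluteGaloisGroup K)) := ε.ker.one_mem
  have hstabμ : ∀ (n : ℕ) (ζ : MuCarrier K n), IsOpen {σ : absoluteGaloisGroup K | mu K n σ ζ = ζ} := by
    intro n ζ
    let H : Subgroup (absoluteGaloisGroup K) :=
      { carrier := {σ | mu K n σ ζ = ζ}
        one_mem' := by simp
        mul_mem' := fun {a b} ha hb ↦ by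
          simp only [Set.mem_setOf_eq] at ha hb ⊢
          rw [map_mul, Module.End.mul_apply, hb, ha]
        inv_mem' := fun {a} ha ↦ by
          simp only [Set.mem_setOf_eq] at ha ⊢
          conv_lhs => rw [← ha]
          rw [← Module.End.mul_apply, ← map_mul, inv_mul_cancel, map_one, Module.End.one_apply] }
    exact H.isOpen_of_mem_nhds (g := 1) ((mu K n).setOf_apply_eq_mem_nhds_one ζ)
  -- `muVal` and integer multiples
  have hmuVal_zsmul : ∀ (n : ℕ) (z : ℤ) (v : MuCarrier K n), muVal K n (z • v) = muVal K n v ^ z := by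
    intro n z v
    have hneg : ∀ w : MuCarrier K n, muVal K n (-w) = (muVal K n w)⁻¹ := fun w ↦ by
      rw [← zero_sub, muVal_sub, muVal_zero, one_div]
    cases z with
    | ofNat i => rw [Int.ofNat_eq_natCast, natCast_zsmul, muVal_nsmul, zpow_natCast]
    | negSucc i => rw [negSucc_zsmul, hneg, muVal_nsmul, zpow_negSucc]
  have hmuVal_mu : ∀ (n : ℕ) (σ : absoluteGaloisGroup K) (v : MuCarrier K n),
      muVal K n (mu K n σ v) = σ • muVal K n v := fun n σ v ↦ rfl
  have hmu_kill : ∀ (n : ℕ) (v : MuCarrier K n), n • v = 0 := fun n v ↦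
    muVal_injective K n (by rw [muVal_nsmul, muVal_pow_eq_one, muVal_zero])
  -- ### the sign actions
  let εZ : absoluteGaloisGroup K →* ℤ := (Units.coeHom ℤ).comp ε
  have hεZ : ∀ σ, εZ σ = ((ε σ : ℤˣ) : ℤ) := fun _ ↦ rfl
  have hεsq : ∀ σ : absoluteGaloisGroup K, ((ε σ : ℤˣ) : ℤ) * ((ε σ : ℤˣ) : ℤ) = 1 := fun σ ↦ by
    rw [← Units.val_mul, Int.units_mul_self, Units.val_one]
  -- twisted Galois action on `μ_n`: `σ ⋆ ζ = ε(σ) • σζ`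
  have hτ : ∀ n : ℕ, ∃ τ : absoluteGaloisGroup K →* Module.End ℤ (MuCarrier K n),
      ∀ σ v, τ σ v = ((ε σ : ℤˣ) : ℤ) • mu K n σ v := by
    intro n
    refine ⟨{ toFun := fun σ ↦ ((ε σ : ℤˣ) : ℤ) • (mu K n).toRepresentation σ
              map_one' := by rw [map_one, map_one, Units.val_one, one_smul]
              map_mul' := fun σ σ' ↦ by rw [map_mul, map_mul, Units.val_mul, smul_mul_smul_comm] }, fun σ v ↦ rfl⟩
  obtain ⟨τM, hτM⟩ := hτ (p ^ (k + d))
  obtain ⟨τk, hτk⟩ := hτ (p ^ k)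
  -- ### the four carriers with their actions
  letI iN : DistribMulAction (absoluteGaloisGroup K) (ZMod (p ^ (k + d))) := DistribMulAction.compHom _ εZ
  letI iN₀ : DistribMulAction (absoluteGaloisGroup K) (ZMod (p ^ k)) := DistribMulAction.compHom _ εZ
  letI iN' : DistribMulAction (absoluteGaloisGroup K) (MuCarrier K (p ^ (k + d))) := DistribMulAction.compHom _ τM
  letI iN₀' : DistribMulAction (absoluteGaloisGroup K) (MuCarrier K (p ^ k)) := DistribMulAction.compHom _ τk
  have hsmulN : ∀ (σ : absoluteGaloisGroup K) (x : ZMod (p ^ (k + d))), σ • x = ((ε σ : ℤˣ) : ℤ) • x := fun _ _ ↦ rfl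
  have hsmulN₀ : ∀ (σ : absoluteGaloisGroup K) (x : ZMod (p ^ k)), σ • x = ((ε σ : ℤˣ) : ℤ) • x := fun _ _ ↦ rfl
  have hsmulN' : ∀ (σ : absoluteGaloisGroup K) (v : MuCarrier K (p ^ (k + d))),
      σ • v = ((ε σ : ℤˣ) : ℤ) • mu K _ σ v := fun σ v ↦ hτM σ v
  have hsmulN₀' : ∀ (σ : absoluteGaloisGroup K) (v : MuCarrier K (p ^ k)),
      σ • v = ((ε σ : ℤˣ) : ℤ) • mu K _ σ v := fun σ v ↦ hτk σ v
  -- open stabilisers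
  have hopenZ : ∀ (n : ℕ) (x : ZMod n), IsOpen {σ : absoluteGaloisGroup K | ((ε σ : ℤˣ) : ℤ) • x = x} := by
    intro n x
    refine hopen_of_mul _ _ hε hker1 fun s hs h hh ↦ ?_
    simp only [Set.mem_setOf_eq] at hs ⊢
    rw [map_mul, Units.val_mul, (MonoidHom.mem_ker).1 hh, Units.val_one, mul_one, hs]
  have hopenμ : ∀ (n : ℕ) (v : MuCarrier K n), IsOpen {σ : absoluteGaloisGroup K | ((ε σ : ℤˣ) : ℤ) • mu K n σ v = v} := by
    intro n v
    refine hopen_of_mul _ ((ε.ker : Set (absoluteGaloisGroup K)) ∩ {σ | mu K n σ v = v}) (hε.inter (hstabμ n v))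
      ⟨hker1, by simp⟩ fun s hs h hh ↦ ?_
    simp only [Set.mem_setOf_eq, Set.mem_inter_iff, SetLike.mem_coe, MonoidHom.mem_ker] at hs hh ⊢
    rw [map_mul, Units.val_mul, hh.1, Units.val_one, mul_one, map_mul, Module.End.mul_apply, hh.2, hs]
  have hN : ∀ x : ZMod (p ^ (k + d)), IsOpen {σ : absoluteGaloisGroup K | σ • x = x} := fun x ↦ hopenZ _ x
  have hN₀ : ∀ x : ZMod (p ^ k), IsOpen {σ : absoluteGaloisGroup K | σ • x = x} := fun x ↦ hopenZ _ x
  have hN' : ∀ v : MuCarrier K (p ^ (k + d)), IsOpen {σ : absoluteGaloisGroup K | σ • v = v} := fun v ↦ by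
    simp only [hsmulN']; exact hopenμ _ v
  have hN₀' : ∀ v : MuCarrier K (p ^ k), IsOpen {σ : absoluteGaloisGroup K | σ • v = v} := fun v ↦ by
    simp only [hsmulN₀']; exact hopenμ _ v
  -- ### the `A`-side maps: `ι_n (z) = e⁻¹ (z • t_n)`, `j (z) = p^d z`
  have hιA : ∀ n : ℕ, ∃ ιn : ZMod (p ^ n) →+ A, ∀ z : ℤ, ιn (z : ZMod (p ^ n)) = e.symm (z • QpModZp.tgen p n) := by
    intro n
    refine ⟨ZMod.lift (p ^ n) ⟨(e.symm : QpModZp p →+ A).comp (zmultiplesHom _ (QpModZp.tgen p n)), ?_⟩, fun z ↦ ?_⟩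
    · change e.symm (((p ^ n : ℕ) : ℤ) • QpModZp.tgen p n) = 0
      rw [natCast_zsmul, QpModZp.pow_nsmul_tgen, map_zero]
    · rw [ZMod.lift_coe]; rfl
  obtain ⟨ι, hι⟩ := hιA (k + d)
  obtain ⟨ι₀, hι₀⟩ := hιA k
  have hj : ∃ j : ZMod (p ^ k) →+ ZMod (p ^ (k + d)), ∀ z : ℤ, j (z : ZMod (p ^ k)) = ((z * (p ^ d : ℕ) : ℤ) : ZMod (p ^ (k + d))) := by
    refine ⟨ZMod.lift (p ^ k) ⟨(Int.castAddHom (ZMod (p ^ (k + d)))).comp (zmultiplesHom ℤ ((p ^ d : ℕ) : ℤ)), ?_⟩, fun z ↦ ?_⟩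
    · change ((((p ^ k : ℕ) : ℤ) • ((p ^ d : ℕ) : ℤ) : ℤ) : ZMod (p ^ (k + d))) = 0
      rw [smul_eq_mul, ← Nat.cast_mul, ← pow_add, Int.cast_natCast, ZMod.natCast_self]
    · rw [ZMod.lift_coe]
      change (((z • ((p ^ d : ℕ) : ℤ) : ℤ)) : ZMod (p ^ (k + d))) = _
      rw [smul_eq_mul]
  obtain ⟨j, hj⟩ := hj
  -- `z • t_n` versus `(z : ℤ_p) • t_n`
  have hzsmul : ∀ (n : ℕ) (z : ℤ), z • QpModZp.tgen p n = (z : ℤ_[p]) • QpModZp.tgen p n := fun n z ↦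
    (Int.cast_smul_eq_zsmul ℤ_[p] z _).symm
  -- ### the dual maps
  -- Kummer embeddings
  have hιK : ∀ n : ℕ, ∃ ιn : MuCarrier K n →+ Additive (AlgebraicClosure K)ˣ, ∀ v, Additive.toMul (ιn v) = muVal K n v :=
    fun n ↦ ⟨AddMonoidHom.mk' (fun v ↦ Additive.ofMul (muVal K n v)) fun a b ↦ by rw [muVal_add, ofMul_mul], fun _ ↦ rfl⟩
  obtain ⟨ι', hι'⟩ := hιK (p ^ (k + d))
  obtain ⟨ι₀', hι₀'⟩ := hιK (p ^ k)
  -- the inclusion `μ_{p^k} ⊆ μ_{p^{k+d}}` and the power map `ζ ↦ ζ^{p^d}`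
  have hincl : ∃ incl : MuCarrier K (p ^ k) →+ MuCarrier K (p ^ (k + d)), ∀ v, muVal K _ (incl v) = muVal K _ v := by
    have hmem : ∀ v : MuCarrier K (p ^ k), muVal K _ v ∈ rootsOfUnity (p ^ (k + d)) (AlgebraicClosure K) := fun v ↦ by
      rw [mem_rootsOfUnity, pow_add, pow_mul, muVal_pow_eq_one, one_pow]
    refine ⟨AddMonoidHom.mk' (fun v ↦ MuCarrier.ofRootsOfUnity ⟨muVal K _ v, hmem v⟩) fun a b ↦ ?_, fun v ↦ rfl⟩
    apply muVal_injective
    change muVal K _ (a + b) = muVal K _ a * muVal K _ b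
    rw [muVal_add]
  obtain ⟨incl, hincl⟩ := hincl
  have hjD : ∃ jD : MuCarrier K (p ^ (k + d)) →+ MuCarrier K (p ^ k), ∀ v, muVal K _ (jD v) = muVal K _ v ^ p ^ d := by
    have hmem : ∀ v : MuCarrier K (p ^ (k + d)), muVal K _ v ^ p ^ d ∈ rootsOfUnity (p ^ k) (AlgebraicClosure K) := fun v ↦ by
      have h := muVal_pow_eq_one K (p ^ (k + d)) v
      rw [show muVal K _ v ^ p ^ (k + d) = (muVal K _ v ^ p ^ d) ^ p ^ k by
        rw [← pow_mul, ← pow_add]; congr 1; rw [Nat.add_comm]] at h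
      rw [mem_rootsOfUnity]
      exact h
    refine ⟨AddMonoidHom.mk' (fun v ↦ MuCarrier.ofRootsOfUnity ⟨muVal K _ v ^ p ^ d, hmem v⟩) fun a b ↦ ?_, fun v ↦ rfl⟩
    apply muVal_injective
    change muVal K _ (a + b) ^ p ^ d = muVal K _ a ^ p ^ d * muVal K _ b ^ p ^ d
    rw [muVal_add, mul_pow]
  obtain ⟨jD, hjD⟩ := hjD
  have hincl_jD : ∀ v, incl (jD v) = (p ^ d : ℕ) • v := fun v ↦
    muVal_injective K _ (by rw [hincl, hjD, muVal_nsmul])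
  -- the pairings `B z ζ = z • ζ`, `B₀ z ζ₀ = z • incl ζ₀`
  have hB : ∃ B : ZMod (p ^ (k + d)) →+ MuCarrier K (p ^ (k + d)) →+ MuCarrier K (p ^ (k + d)),
      ∀ (z : ℤ) (v : MuCarrier K (p ^ (k + d))), B (z : ZMod (p ^ (k + d))) v = z • v := by
    refine ⟨ZMod.lift (p ^ (k + d)) ⟨zmultiplesHom _ (AddMonoidHom.id (MuCarrier K (p ^ (k + d)))), ?_⟩, fun z v ↦ ?_⟩
    · refine AddMonoidHom.ext fun v ↦ ?_
      change ((p ^ (k + d) : ℕ) : ℤ) • v = 0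
      rw [natCast_zsmul, hmu_kill]
    · rw [ZMod.lift_coe]; rfl
  obtain ⟨B, hB⟩ := hB
  have hB₀ : ∃ B₀ : ZMod (p ^ k) →+ MuCarrier K (p ^ k) →+ MuCarrier K (p ^ (k + d)),
      ∀ (z : ℤ) (v : MuCarrier K (p ^ k)), B₀ (z : ZMod (p ^ k)) v = z • incl v := by
    refine ⟨ZMod.lift (p ^ k) ⟨zmultiplesHom _ incl, ?_⟩, fun z v ↦ ?_⟩
    · refine AddMonoidHom.ext fun v ↦ ?_
      change ((p ^ k : ℕ) : ℤ) • incl v = 0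
      rw [natCast_zsmul, ← map_nsmul, hmu_kill, map_zero]
    · rw [ZMod.lift_coe]; rfl
  obtain ⟨B₀, hB₀⟩ := hB₀
  -- ### everything in integer coordinates
  have hZ : ∀ (n : ℕ) (a : ZMod n) [NeZero n], ∃ z : ℤ, (z : ZMod n) = a := fun n a _ ↦ ZMod.intCast_surjective a
  -- equivariance of `mu` through the maps
  have hincl_mu : ∀ (σ : absoluteGaloisGroup K) (v : MuCarrier K (p ^ k)),
      incl (mu K _ σ v) = mu K _ σ (incl v) := fun σ v ↦
    muVal_injective K _ (by rw [hincl, hmuVal_mu, hmuVal_mu, hincl])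
  have hjD_mu : ∀ (σ : absoluteGaloisGroup K) (v : MuCarrier K (p ^ (k + d))),
      jD (mu K _ σ v) = mu K _ σ (jD v) := fun σ v ↦
    muVal_injective K _ (by rw [hjD, hmuVal_mu, hmuVal_mu, hjD, smul_pow'])
  -- ### the witnesses
  refine ⟨ZMod (p ^ k), ZMod (p ^ (k + d)), MuCarrier K (p ^ k), MuCarrier K (p ^ (k + d)),
    inferInstance, iN₀, inferInstance, inferInstance, inferInstance,
    inferInstance, iN, inferInstance, inferInstance, inferInstance,
    inferInstance, iN₀', inferInstance, inferInstance,
    inferInstance, iN', inferInstance, inferInstance,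
    hN₀, hN, hN₀', hN', j, ι₀, ι, B, B₀, jD, ι', ι₀',
    hsmulN₀, hsmulN, ?_, ?_, ?_, ?_, ?_, ?_, ?_, ?_, ?_, ?_, ?_, ?_, ?_, ?_, ?_, ?_, ?_, ?_, ?_, ?_⟩
  · -- `p^M • N = 0`
    intro x
    rw [nsmul_eq_mul, ZMod.natCast_self, zero_mul]
  · -- `j` equivariant
    intro σ m
    rw [hsmulN₀, hsmulN, map_zsmul]
  · -- `ι₀` equivariant
    intro σ m
    rw [hsmulN₀, hAε, map_zsmul]
  · -- `ι₀` injective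
    intro a b hab
    obtain ⟨za, rfl⟩ := hZ _ a
    obtain ⟨zb, rfl⟩ := hZ _ b
    rw [hι₀, hι₀, e.symm.apply_eq_iff_eq, hzsmul, hzsmul, ← sub_eq_zero, ← sub_smul, ← Int.cast_sub,
      QpModZp.smul_tgen_eq_zero_iff, ← PadicInt.norm_le_pow_iff_mem_span_pow, PadicInt.norm_int_le_pow_iff_dvd] at hab
    exact (ZMod.intCast_eq_intCast_iff_dvd_sub za zb (p ^ k)).mpr (by rw [dvd_sub_comm]; exact_mod_cast hab)
  · -- `A[p^k] ⊆ range ι₀`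
    intro a ha
    have hx : p ^ k • e a = 0 := by rw [← map_nsmul, ha, map_zero]
    obtain ⟨m, hm⟩ := QpModZp_exists_eq_natCast_smul_tgen_of_nsmul_eq_zero hx
    refine ⟨((m : ℤ) : ZMod (p ^ k)), ?_⟩
    rw [hι₀, hzsmul, Int.cast_natCast, ← hm, e.symm_apply_apply]
  · -- `ι` equivariant
    intro σ m
    rw [hsmulN, hAε, map_zsmul]
  · -- `ι ∘ j = ι₀`
    intro m
    obtain ⟨z, rfl⟩ := hZ _ m
    rw [hj, hι, hι₀, hzsmul, hzsmul, Int.cast_mul, Int.cast_natCast, Nat.cast_pow, mul_smul,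
      QpModZp.pow_smul_tgen_add]
  · -- `A` is `p^k`-divisible
    intro a
    obtain ⟨n, u, hu⟩ := QpModZp.exists_eq_smul_tgen (e a)
    refine ⟨e.symm (u • QpModZp.tgen p (n + k)), ?_⟩
    rw [← map_nsmul, ← Nat.cast_smul_eq_nsmul ℤ_[p], smul_comm, Nat.cast_pow, QpModZp.pow_smul_tgen_add, ← hu,
      e.symm_apply_apply]
  · -- `p^M • N' = 0`
    exact hmu_kill _
  · -- `B` equivariant
    intro σ m v
    obtain ⟨z, rfl⟩ := hZ _ m
    rw [ofSMul_apply_apply, ofSMul_apply_apply, hsmulN, hsmulN', zsmul_eq_mul, ← Int.cast_mul, hB, hB, map_zsmul,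
      smul_smul, show ((ε σ : ℤˣ) : ℤ) * z * ((ε σ : ℤˣ) : ℤ) = z by rw [mul_comm, ← mul_assoc, hεsq, one_mul]]
  · -- `B` perfect on the right
    constructor
    · intro v w hvw
      have h := DFunLike.congr_fun hvw ((1 : ℤ) : ZMod (p ^ (k + d)))
      simp only [AddMonoidHom.flip_apply] at h
      rwa [hB, hB, one_zsmul, one_zsmul] at h
    · intro f
      refine ⟨f ((1 : ℤ) : ZMod (p ^ (k + d))), AddMonoidHom.ext fun a ↦ ?_⟩
      obtain ⟨z, rfl⟩ := hZ _ a
      simp only [AddMonoidHom.flip_apply]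
      rw [hB, ← map_zsmul, zsmul_eq_mul, ← Int.cast_mul, mul_one]
  · -- `B₀` equivariant
    intro σ m v
    obtain ⟨z, rfl⟩ := hZ _ m
    rw [ofSMul_apply_apply, ofSMul_apply_apply, hsmulN₀, hsmulN₀', zsmul_eq_mul, ← Int.cast_mul, hB₀, hB₀, map_zsmul,
      hincl_mu, map_zsmul, smul_smul,
      show ((ε σ : ℤˣ) : ℤ) * z * ((ε σ : ℤˣ) : ℤ) = z by rw [mul_comm, ← mul_assoc, hεsq, one_mul]]
  · -- `jD` equivariant
    intro σ v
    rw [hsmulN', hsmulN₀', map_zsmul, hjD_mu]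
  · -- the transpose identity
    intro m₀ v
    obtain ⟨z, rfl⟩ := hZ _ m₀
    rw [hB₀, hj, hB, hincl_jD, mul_smul, natCast_zsmul]
  · -- `ι′` injective
    intro a b h
    exact muVal_injective K _ (by rw [← hι', ← hι', h])
  · -- `ι′` twisted-equivariant
    intro g x
    rw [hι', hι', hsmulN', hmuVal_zsmul, hmuVal_mu]
  · -- `ι₀′` injective
    intro a b h
    exact muVal_injective K _ (by rw [← hι₀', ← hι₀', h])
  · -- `ι₀′` twisted-equivariant
    intro g x
    rw [hι₀', hι₀', hsmulN₀', hmuVal_zsmul, hmuVal_mu]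
  · -- `μ_{p^k} ⊆ image ι₀′`
    intro m hm
    exact ⟨MuCarrier.ofRootsOfUnity ⟨m, (mem_rootsOfUnity _ _).2 hm⟩, by rw [hι₀']; rfl⟩
  · -- `ι₀′ ∘ jD = (·)^{p^{M-k}} ∘ ι′`
    intro x
    rw [hι₀', hι', hjD, hdk]

end Summit.BirchSwinnertonDyer.BirchSwinnertonDyer.Theorems.PrintCf2.LayerShapiro

end
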